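import Literature.Analysis.FluidPDE.TaoH1AlmostRegular
import Literature.Analysis.FluidPDE.NSQuasipotential
import HarnessLib

/-!
# Tao (2011/2013), Thm. 5.4 = arXiv Thm. 31 «Local well-posedness in H¹» WITH FORCING, and the
# positive-time regularity of the forced local solution (Lemma 5.5 = arXiv Lemma 32, Thm. 5.4 (iv))

Named fact (D-0014: `def … : Prop`, nothing asserted) — the FORCED twin of the accepted
`Literature.Analysis.FluidPDE.tao2011_H1_local_almost_regular` / `TaoH1AlmostRegularWith c`
(file `TaoH1AlmostRegular.lean`, homogeneous case `f = 0`), requested by cite item wi-70699 for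
the crux `HeredityAtOne` of `Summits/NavierStokesRegularity` (a restart at a good `H¹` time inside
a forced era, combined with the proved forced weak–strong uniqueness
`serrinMasuda_weak_strong_uniqueness_forced`).

## The printed statements (`ν = 1`; arXiv:1108.1165, held as `paper:arxiv-1108.1165`)

§1 (arXiv p. 6): an *`H¹` mild solution* `(u, p, u₀, f, T)` has `u₀ ∈ H¹_x(ℝ³)`,
`f ∈ L^∞_t H¹_x([0,T] × ℝ³)`, `u ∈ L^∞_t H¹_x ∩ L²_t H²_x([0,T] × ℝ³)`, `p` given by (pressure-point),
`u₀` and `u` divergence free, and Duhamel's formula; "similarly define the concept of `H¹` data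
`(u₀, f, T)`".

**Theorem 31** (= Thm. 5.4; arXiv p. 18, lines 38–60). "Let `(u₀, f, T)` be `H¹` data.
(i) (Strong solution) If `(u, p, u₀, f, T, 1)` is an `H¹` mild solution, then
`u ∈ C⁰_t H¹_x([0,T] × ℝ³)`. (ii) (Local existence and regularity) If
`(‖u₀‖_{H¹_x(ℝ³)} + ‖f‖_{L¹_t H¹_x(ℝ³)})⁴ T ≤ c` for a sufficiently small absolute constant `c > 0`,
then there exists a `H¹` mild solution `(u, p, u₀, f, T)` with the indicated data, with
`‖u‖_{X¹([0,T] × ℝ³)} ≲ ‖u₀‖_{H¹_x} + ‖f‖_{L¹_t H¹_x}` and more generally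
`‖u‖_{X^k([0,T] × ℝ³)} ≲_{k, ‖u₀‖_{H^k_x}, ‖f‖_{L¹_t H^k_x}, 1}` for each `k ≥ 1`. […]
(iii) (Uniqueness) There is at most one `H¹` mild solution `(u, p, u₀, f, T)` with the indicated
data. (iv) (Regularity) If `(u, p, u₀, f, T, 1)` is a `H¹` mild solution, and `(u₀, f, T)` is
Schwartz, then `u` and `p` are smooth; in fact, one has `∂ₜʲu, ∂ₜʲp ∈ L^∞_t H^k([0,T] × ℝ³)` for all
`j, k ≥ 0`." — with, in the proof of (iv) (p. 18, line 81): "(Note that these arguments did not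
require the full power of the hypothesis that `(u₀, f, T)` was Schwartz; it would have sufficed to
have `u₀ ∈ H^k_x(ℝ³)` and `f ∈ Cʲ_t H^k_x(ℝ³)` for all `j, k ≥ 0`.)"

**Lemma 32** (= Lemma 5.5, Quantitative regularity; arXiv p. 18, line 88). "Let `(u, p, u₀, f, T)`
be an `H¹` mild solution obeying (D4) for a sufficiently small absolute constant `c > 0`, and such
that `‖u₀‖_{H¹_x(ℝ³)} + ‖f‖_{L¹_t H^k_x(ℝ³)} ≤ M < ∞`. Then one has
`‖u‖_{L^∞_t H^k_x([τ,T] × ℝ³)} ≲_{k,τ,T,M} 1` for all natural numbers `k ≥ 1` and all `0 < τ < T`."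

## Rendering (exactly parallel to `TaoH1AlmostRegularWith`; differences flagged)

* FORCE CLASS: the fact is vendored for the forces of the Clay class used by the consumer —
  `f` smooth on the closed half-space `[0,∞) × ℝ³` with Fefferman's space-time rapid decay (the
  accepted `IsSmoothOnHalfSpace f`, `HasRapidSpaceTimeDecay f` of `NSWave0.lean`); such an `f` is
  `H¹` data (`f ∈ L^∞_t H¹_x`) and lies in `Cʲ_t H^k_x` for all `j, k` (the hypothesis of the note to
  (iv)) and in `L¹_t H^k_x([0,T])` for all `k` (the hypothesis of Lemma 32). The printed theorem allows
  general `f ∈ L^∞_t H¹_x`; -- TODO(general form): Thm. 31 (i)–(iii) for `f ∈ L^∞_t H¹_x` without the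
  smoothness clause.
* VISCOSITY `ν > 0` by the rescaling of Tao's footnote 3 extended to the force:
  `v(s,x) = ν⁻¹u(s/ν,x)`, `q(s,x) = ν⁻²p(s/ν,x)`, `g(s,x) = ν⁻²f(s/ν,x)` on `[0, νT]`, under which
  `‖v(0)‖_{H¹} = ν⁻¹‖u₀‖_{H¹}` and `‖g‖_{L¹_s H¹_x([0,νT])} = ν⁻¹‖f‖_{L¹_t H¹_x([0,T])}`, so that (D4)
  reads `(‖u₀‖_{H¹} + ‖f‖_{L¹_t H¹_x})⁴ T ≤ c ν³`; with the squared norm `‖u₀‖²_{H¹} = eH1NormSq u₀ ≤ A`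
  and `‖f‖_{L¹_t H¹_x([0,T])} = ∫₀ᵀ (eH1NormSq (f t))^{1/2} dt ≤ B` it is asked as
  `(√A + B)⁴ T ≤ c ν³` (for `B = 0` this is the homogeneous `A² T ≤ c ν³`, see
  `TaoForcedH1AlmostRegularWith.toHomogeneous`).
* The `H¹` mild solution of (ii) is rendered, as in the homogeneous decl, by its consequences used
  downstream: a Leray–Hopf weak solution of the FORCED system on `ℝ³ × [0,T)` from `u₀` (the
  accepted `IsLerayHopfOn T ν f u₀ v`; an `L^∞H¹ ∩ L²H² ∩ C⁰_t H¹_x` solution with force in `L²L²`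
  satisfies Leray's energy equality with the work term `2∫∫u·f` and is therefore Leray–Hopf —
  Lemarié-Rieusset 2016, Def. 12.3 and the sentence following it, PDF p. 406), attaining the datum
  (`v 0 = u₀`), `H¹`-continuous on `[0,T]` (item (i); the accepted `IsH1RegularOn (Icc 0 T) v`).
* POSITIVE-TIME SMOOTHNESS (the clause the homogeneous decl takes from Prop. 5.6): here it is the
  printed chain Lemma 32 (`u ∈ L^∞_t H^k_x([τ,T])` for all `k`, the force being in every
  `L¹_t H^k_x`) → time translation to `[τ, T]` (an `H¹` mild solution from the datum `u(τ) ∈ ⋂ₖ H^k`,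
  force `f(τ + ·) ∈ Cʲ_t H^k_x`) → Thm. 31 (iv) with its note and (iii): `u, p` are smooth on
  `[τ,T] × ℝ³` with `∂ₜʲu, ∂ₜʲp ∈ L^∞_t H^k_x([τ,T] × ℝ³)`; rendered exactly as in the homogeneous
  decl by a classical solution `(w, π)` of the FORCED system on the slab
  (`IsClassicalNSSolutionOn (Icc τ T) ν f w π`) with all `L²` Sobolev norms of `w`, `∂ₜw`, `π`
  bounded on `[τ,T]`, representing `v` (`v t = w t` a.e., `t ∈ [τ,T]`). Only first-order time
  derivatives are recorded, as in the homogeneous decl.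

Nothing is asserted; users take `(h : tao2011_forced_H1_local_almost_regular)`.

## Tree search

`lean search 'forced|Forced'` in `FluidPDE`: `serrinMasuda_weak_strong_uniqueness_forced`
(proved), `sohr2001_serrinMasuda_uniqueness_forced_memLp`, `TaoForcedBoundedTotalSpeed`,
`TaoForcedUniquenessClayForce` (Clay-force slice lemmas `clayForce_*`); no forced local `H¹`
existence/regularity statement. The homogeneous decls are not touched.

## References

* T. Tao, *Localisation and compactness properties of the Navier–Stokes global regularity
  problem*, Anal. PDE 6 (2013) 25–107 = arXiv:1108.1165: §1 p. 6 (`H¹` mild solutions and data),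
  Thm. 5.4 = arXiv Thm. 31 (p. 18), Lemma 5.5 = arXiv Lemma 32 (p. 18), footnote 3. [Tao2011]
* P. G. Lemarié-Rieusset, *The Navier–Stokes Problem in the 21st Century*, CRC 2016, Def. 12.3
  (PDF p. 406). [LemarieRieusset2016]
-/

noncomputable section

open MeasureTheory Set
open scoped ENNReal NNReal

namespace Literature.Analysis.FluidPDE


/-- The content of `tao2011_forced_H1_local_almost_regular` with a given smallness constant `c`
(Tao's Thm. 31 (i)–(ii) with Lemma 32 and Thm. 31 (iii)–(iv), force of the Clay class, `ν > 0` by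
rescaling): for `ν > 0`, `T > 0`, a divergence-free `u₀ ∈ H¹(ℝ³)` with `‖u₀‖²_{H¹} ≤ A`, a force `f`
smooth on `[0,∞) × ℝ³` with rapid space-time decay and `‖f‖_{L¹_t H¹_x([0,T])} ≤ B`, and
`(√A + B)⁴ T ≤ c ν³`, there is a Leray–Hopf weak solution `v` of the forced system on `ℝ³ × [0,T)`
from `u₀` with `v 0 = u₀`, `H¹`-continuous on `[0,T]`, which on every slab `[τ,T]`, `0 < τ < T`,
is represented by a classical solution `(w, π)` of the forced system with all `L²` Sobolev norms of
`w`, `∂ₜw`, `π` bounded on `[τ,T]`. See the module docstring for the rendering and the printed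
chain behind the last clause.
[cite: Tao2011, Thm. 5.4 = arXiv Thm. 31 (i)-(iv) with Lemma 5.5 = arXiv Lemma 32, pp. 18-19] -/
def TaoForcedH1AlmostRegularWith (c : ℝ) : Prop :=
  ∀ ⦃ν T : ℝ⦄, 0 < ν → 0 < T →
    ∀ ⦃u₀ : EuclideanSpace ℝ (Fin 3) → EuclideanSpace ℝ (Fin 3)⦄,
    MemLp u₀ 2 volume → IsWeaklyDivFree u₀ →
    ∀ ⦃f : ℝ → EuclideanSpace ℝ (Fin 3) → EuclideanSpace ℝ (Fin 3)⦄,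
    IsSmoothOnHalfSpace f → HasRapidSpaceTimeDecay f →
    ∀ ⦃A B : ℝ⦄, 0 ≤ A → 0 ≤ B → eH1NormSq u₀ ≤ ENNReal.ofReal A →
      ∫⁻ t in Ioo 0 T, eH1NormSq (f t) ^ (2⁻¹ : ℝ) ≤ ENNReal.ofReal B →
      (Real.sqrt A + B) ^ 4 * T ≤ c * ν ^ 3 →
      ∃ v : ℝ → EuclideanSpace ℝ (Fin 3) → EuclideanSpace ℝ (Fin 3),
        IsLerayHopfOn T ν f u₀ v ∧ v 0 = u₀ ∧ IsH1RegularOn (Icc 0 T) v ∧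
        ∀ ⦃τ : ℝ⦄, τ ∈ Ioo 0 T →
          ∃ (w : ℝ → EuclideanSpace ℝ (Fin 3) → EuclideanSpace ℝ (Fin 3))
            (π : ℝ → EuclideanSpace ℝ (Fin 3) → ℝ),
          IsClassicalNSSolutionOn (Icc τ T) ν f w π ∧
          HasBoundedSobolevNormsOn (Icc τ T) w ∧
          HasBoundedSobolevNormsOn (Icc τ T) (timeDerivWithin (Icc τ T) w) ∧
          (∀ n : ℕ, ∃ C : ℝ≥0, ∀ t ∈ Icc τ T, ∫⁻ x, ‖iteratedFDeriv ℝ n (π t) x‖ₑ ^ 2 ≤ C) ∧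
          ∀ t ∈ Icc τ T, v t =ᵐ[volume] w t

/-- **Tao's local `H¹` theory with forcing: the local solution from `H¹` data and a Clay-class
force is almost regular** (Tao 2011/2013, Thm. 5.4 = arXiv Thm. 31 with Lemma 5.5 = Lemma 32): there
is an absolute constant `c > 0` such that `TaoForcedH1AlmostRegularWith c` holds. Nothing is
asserted; users take `(h : tao2011_forced_H1_local_almost_regular)`.
[cite: Tao2011, Thm. 5.4 = arXiv Thm. 31 (i)-(iv) with Lemma 5.5 = arXiv Lemma 32, pp. 18-19] -/
def tao2011_forced_H1_local_almost_regular : Prop :=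
  ∃ c : ℝ, 0 < c ∧ TaoForcedH1AlmostRegularWith c

/-- Monotonicity in the smallness constant. [cite: Tao2011, Thm. 5.4 (ii)] -/
theorem TaoForcedH1AlmostRegularWith.mono {c c' : ℝ} (h : TaoForcedH1AlmostRegularWith c)
    (hc : c' ≤ c) : TaoForcedH1AlmostRegularWith c' :=
  fun _ν _T hν hT _u₀ hu₀ hdiv _f hfs hfd _A _B hA hB hH1 hL1 hsmall =>
    h hν hT hu₀ hdiv hfs hfd hA hB hH1 hL1
      (hsmall.trans (mul_le_mul_of_nonneg_right hc (pow_nonneg hν.le 3)))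

/-- Forgetting the smoothing clause: local forced Leray–Hopf solutions from `H¹` data which attain
the datum and are `H¹`-continuous on `[0,T]` (Thm. 31 (i)–(ii) alone).
[cite: Tao2011, Thm. 5.4 (i)-(ii)] -/
theorem TaoForcedH1AlmostRegularWith.exists_isH1RegularOn {c : ℝ}
    (h : TaoForcedH1AlmostRegularWith c) {ν T : ℝ} (hν : 0 < ν) (hT : 0 < T)
    {u₀ : EuclideanSpace ℝ (Fin 3) → EuclideanSpace ℝ (Fin 3)} (hu₀ : MemLp u₀ 2 volume)
    (hdiv : IsWeaklyDivFree u₀) {f : ℝ → EuclideanSpace ℝ (Fin 3) → EuclideanSpace ℝ (Fin 3)}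
    (hfs : IsSmoothOnHalfSpace f) (hfd : HasRapidSpaceTimeDecay f) {A B : ℝ} (hA : 0 ≤ A)
    (hB : 0 ≤ B) (hH1 : eH1NormSq u₀ ≤ ENNReal.ofReal A)
    (hL1 : ∫⁻ t in Ioo 0 T, eH1NormSq (f t) ^ (2⁻¹ : ℝ) ≤ ENNReal.ofReal B)
    (hsmall : (Real.sqrt A + B) ^ 4 * T ≤ c * ν ^ 3) :
    ∃ v : ℝ → EuclideanSpace ℝ (Fin 3) → EuclideanSpace ℝ (Fin 3),
      IsLerayHopfOn T ν f u₀ v ∧ v 0 = u₀ ∧ IsH1RegularOn (Icc 0 T) v := by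
  obtain ⟨v, hv, hv0, hreg, -⟩ := h hν hT hu₀ hdiv hfs hfd hA hB hH1 hL1 hsmall
  exact ⟨v, hv, hv0, hreg⟩

/-! ### Consistency with the homogeneous decl: the zero force -/

/-- The zero force is smooth on the half-space (private helper; a public copy lives in a
`Summits/` file, not importable here). [folklore] -/
private theorem isSmoothOnHalfSpace_zero' :
    IsSmoothOnHalfSpace (0 : ℝ → EuclideanSpace ℝ (Fin 3) → EuclideanSpace ℝ (Fin 3)) := by
  simpa [IsSmoothOnHalfSpace, Function.uncurry_def] using contDiffOn_const

/-- The zero force has rapid space-time decay (private helper). [folklore] -/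
private theorem hasRapidSpaceTimeDecay_zero' :
    HasRapidSpaceTimeDecay (0 : ℝ → EuclideanSpace ℝ (Fin 3) → EuclideanSpace ℝ (Fin 3)) := by
  intro n K
  refine ⟨0, fun t _ x => ?_⟩
  have h0 : Function.uncurry (0 : ℝ → EuclideanSpace ℝ (Fin 3) → EuclideanSpace ℝ (Fin 3)) = 0 := by
    funext z; rfl
  rw [h0, iteratedFDerivWithin_zero]
  simp

/-- The zero field has squared `H¹` norm `0` (private helper). [folklore] -/
private theorem eH1NormSq_zero' :
    eH1NormSq (0 : EuclideanSpace ℝ (Fin 3) → EuclideanSpace ℝ (Fin 3)) = 0 := by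
  rw [eH1NormSq_def]
  have h1 : eEnergy (0 : EuclideanSpace ℝ (Fin 3) → EuclideanSpace ℝ (Fin 3)) = 0 := by
    simp [eEnergy]
  have h2 : eWeakGradL2Sq (0 : EuclideanSpace ℝ (Fin 3) → EuclideanSpace ℝ (Fin 3)) = 0 :=
    le_antisymm ((eWeakGradL2Sq_le_of_hasWeakGradient hasWeakGradient_zero).trans (by simp))
      bot_le
  rw [h1, h2, add_zero]

/-- **Consistency check**: specialised to the zero force (`B = 0`), the forced statement with
constant `c` is exactly the homogeneous `TaoH1AlmostRegularWith c` (`(√A)⁴ = A²`).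
[cite: Tao2011, Thm. 5.4 with Prop. 5.6 (homogeneous case)] -/
theorem TaoForcedH1AlmostRegularWith.toHomogeneous {c : ℝ} (h : TaoForcedH1AlmostRegularWith c) :
    TaoH1AlmostRegularWith c := by
  intro ν T hν hT u₀ hu₀ hdiv A hA hH1 hsmall
  have hL1 :
      ∫⁻ t in Ioo 0 T, eH1NormSq ((0 : ℝ → EuclideanSpace ℝ (Fin 3) → EuclideanSpace ℝ (Fin 3)) t) ^ (2⁻¹ : ℝ) ≤
        ENNReal.ofReal 0 := by
    have h0 :
        (fun t => eH1NormSq ((0 : ℝ → EuclideanSpace ℝ (Fin 3) → EuclideanSpace ℝ (Fin 3)) t) ^ (2⁻¹ : ℝ)) =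
          fun _ => 0 := by
      funext t
      rw [Pi.zero_apply, eH1NormSq_zero', ENNReal.zero_rpow_of_pos (by norm_num)]
    rw [h0, lintegral_zero, ENNReal.ofReal_zero]
  have hsmall' : (Real.sqrt A + 0) ^ 4 * T ≤ c * ν ^ 3 := by
    have hsq : (Real.sqrt A + 0) ^ 4 = A ^ 2 := by
      rw [add_zero, show (4 : ℕ) = 2 * 2 from rfl, pow_mul, Real.sq_sqrt hA]
    rw [hsq]; exact hsmall
  exact h hν hT hu₀ hdiv isSmoothOnHalfSpace_zero' hasRapidSpaceTimeDecay_zero' hA le_rfl hH1 hL1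
    hsmall'

end Literature.Analysis.FluidPDE

end
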